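import Mathlib
import Summits.ValiantsHypothesis.ValiantsHypothesis.Theses.LiouvilleSarnak
import Summits.ValiantsHypothesis.ValiantsHypothesis.Theorems.LiouvilleSarnakCutRankEight
import Summits.ValiantsHypothesis.ValiantsHypothesis.Theorems.LiouvilleSarnakLiouvilleCutRankOneScaleBalancedWindow
import Summits.ValiantsHypothesis.ValiantsHypothesis.Theorems.LiouvilleSarnakLiouvilleCutRankOneScaleWindowEmbedding

/-!
# Route LiouvilleSarnak — crux `LiouvilleCutRank` (stmt-ValiantsHypothesis-14775), line
# `one_scale`: SCALE TRANSFER, and the open stub `stub_rankAtOneScale` is EQUIVALENT to the crux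

The registered line `Cruxes/LiouvilleCutRank/Lines/one_scale.lean` has three stubs; the two
"provable now" ones are PROVED (`stub_balancedWindow`, `stub_windowEmbedding`, files
`Theorems/LiouvilleSarnakLiouvilleCutRankOneScale{BalancedWindow,WindowEmbedding}.lean`).  Their
content is the following unconditional SCALE TRANSFER for the Liouville digital cut matrices
`M_π(r,c) = λ(N_π(r,c) + 1)`:

* §1 `le_rank_of_forall_level` — if EVERY cut at level `n₁` has rank `≥ W`, then every cut at every
  level `n ≥ n₁²` has rank `≥ W` (the minimum rank over balanced cuts is monotone from level `n₁` to
  all levels `≥ n₁²`).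

Consequences for the line's remaining stub `stub_rankAtOneScale` ("for every `W` there is ONE level
at which every cut has rank `≥ W`"):

* §2 `liouvilleCutRank_iff_rankAtOneScale` — the stub (verbatim statement) is EQUIVALENT to the crux
  `LiouvilleCutRank` (→: §1, the skeleton's composition; ←: take the level `n₀(W)` of the crux).  So
  the line is a REFORMULATION (quantifier collapse `∀ n ≥ n₀ ↦ ∃ n₁`), and its arithmetic content is
  the crux itself; its value is that every instance `W ≤ W₀` is a finite statement about ONE level.
* §3 `rankAtOneScale_of_le_eight` — the stub holds for every `W ≤ 8` (from the tree's rung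
  `LiouvilleSarnakCutRankEight.liouvilleCutRank_of_le_eight`); the first open instance is `W = 9`
  (refuter census on the item: min rank over balanced cuts at levels `1..7` is
  `1, 3, 6, 15, 32, 64, 128`, so level `4` should certify `W ≤ 15` and level `5` `W ≤ 32`).

Honest framing: structural bookkeeping for a registered line; the crux `LiouvilleCutRank` (every
`W`), `DigitalBilinearLiouville` and `AlgebraicSarnak` stay OPEN, and nothing here bears on VP versus
VNP.  No definitions (the stub's statement is written out verbatim in the theorem types).
-/

-- the directory `ValiantsHypothesis/ValiantsHypothesis` repeats the summit name (tree layout)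
set_option linter.dupNamespace false

namespace Summit.ValiantsHypothesis.ValiantsHypothesis.Theorems.LiouvilleSarnakLiouvilleCutRank.OneScale

open Summit.ValiantsHypothesis.ValiantsHypothesis.Theses.LiouvilleSarnak
open Summit.ValiantsHypothesis.ValiantsHypothesis.Theorems.LiouvilleSarnakCutRankEight
  (liouvilleCutRank_of_le_eight)

/-! ### §1 Scale transfer -/

/-- **Scale transfer (the content of Stubs 1–2 of line `one_scale`).**  If every cut matrix at level
`n₁` has rank `≥ W`, then every cut matrix at every level `n ≥ n₁ · n₁` has rank `≥ W`: a balanced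
`2n₁`-window exists (`stub_balancedWindow`) and the induced level-`n₁` cut embeds
(`stub_windowEmbedding`). [folklore] -/
theorem le_rank_of_forall_level (W n₁ : ℕ)
    (h : ∀ π₁ : Fin n₁ ⊕ Fin n₁ ≃ Fin (2 * n₁),
      W ≤ (Matrix.of fun r c : Fin n₁ → Bool =>
        (((ArithmeticFunction.liouville
          (Nat.ofBits (fun j : Fin (2 * n₁) => Sum.elim r c (π₁.symm j)) + 1) : ℤ) : ℂ))).rank)
    (n : ℕ) (hn : n₁ * n₁ ≤ n) (π : Fin n ⊕ Fin n ≃ Fin (2 * n)) :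
    W ≤ (Matrix.of fun r c : Fin n → Bool =>
      (((ArithmeticFunction.liouville
        (Nat.ofBits (fun j : Fin (2 * n) => Sum.elim r c (π.symm j)) + 1) : ℤ) : ℂ))).rank := by
  obtain ⟨s, hs, hcount⟩ :=
    stub_balancedWindow n₁ n hn π (fun k => if h : k < 2 * n then (π.symm ⟨k, h⟩).isLeft else false)
      (fun j => by simp [j.isLt])
  obtain ⟨π₁, hle⟩ :=
    stub_windowEmbedding n₁ n π (fun k => if h : k < 2 * n then (π.symm ⟨k, h⟩).isLeft else false)
      (fun j => by simp [j.isLt]) s hs hcount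
  exact (h π₁).trans hle

/-! ### §2 The open stub is the crux -/

/-- **Stub ⇒ crux** (the skeleton's composition, now unconditional in its two transfer stubs): if
for every `W` some level `n₁` has all cut ranks `≥ W`, then `LiouvilleCutRank` (with
`n₀ = n₁ · n₁`). [folklore] -/
theorem liouvilleCutRank_of_rankAtOneScale
    (h : ∀ W : ℕ, ∃ n₁ : ℕ, ∀ π₁ : Fin n₁ ⊕ Fin n₁ ≃ Fin (2 * n₁),
      W ≤ (Matrix.of fun r c : Fin n₁ → Bool =>
        (((ArithmeticFunction.liouville
          (Nat.ofBits (fun j : Fin (2 * n₁) => Sum.elim r c (π₁.symm j)) + 1) : ℤ) : ℂ))).rank) :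
    LiouvilleCutRank := by
  intro W
  obtain ⟨n₁, hn₁⟩ := h W
  exact ⟨n₁ * n₁, fun n hn π => le_rank_of_forall_level W n₁ hn₁ n hn π⟩

/-- **Crux ⇒ stub**: `LiouvilleCutRank` gives, for every `W`, a level (`n₁ = n₀(W)`) at which every
cut has rank `≥ W`. [folklore] -/
theorem rankAtOneScale_of_liouvilleCutRank (h : LiouvilleCutRank) :
    ∀ W : ℕ, ∃ n₁ : ℕ, ∀ π₁ : Fin n₁ ⊕ Fin n₁ ≃ Fin (2 * n₁),
      W ≤ (Matrix.of fun r c : Fin n₁ → Bool =>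
        (((ArithmeticFunction.liouville
          (Nat.ofBits (fun j : Fin (2 * n₁) => Sum.elim r c (π₁.symm j)) + 1) : ℤ) : ℂ))).rank := by
  intro W
  obtain ⟨n₀, hn₀⟩ := h W
  exact ⟨n₀, fun π₁ => hn₀ n₀ le_rfl π₁⟩

/-- **`LiouvilleCutRank` ⟺ `stub_rankAtOneScale`** (the open stub of line `one_scale` is a
reformulation of the crux stmt-ValiantsHypothesis-14775: `∀ W ∃ n₀ ∀ n ≥ n₀ ∀ π` collapses to
`∀ W ∃ n₁ ∀ π₁` by the scale transfer §1). [folklore] -/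
theorem liouvilleCutRank_iff_rankAtOneScale :
    LiouvilleCutRank ↔
    ∀ W : ℕ, ∃ n₁ : ℕ, ∀ π₁ : Fin n₁ ⊕ Fin n₁ ≃ Fin (2 * n₁),
      W ≤ (Matrix.of fun r c : Fin n₁ → Bool =>
        (((ArithmeticFunction.liouville
          (Nat.ofBits (fun j : Fin (2 * n₁) => Sum.elim r c (π₁.symm j)) + 1) : ℤ) : ℂ))).rank :=
  ⟨rankAtOneScale_of_liouvilleCutRank, liouvilleCutRank_of_rankAtOneScale⟩

/-- **Monotone form of the crux.**  `LiouvilleCutRank` is equivalent to: the minimum cut rank is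
UNBOUNDED along levels, i.e. for every `W` and every `m` some level `n₁ ≥ m` has all cut ranks `≥ W`
(§1 upgrades one good level to all larger square levels). [folklore] -/
theorem liouvilleCutRank_iff_frequently :
    LiouvilleCutRank ↔
    ∀ W m : ℕ, ∃ n₁ ≥ m, ∀ π₁ : Fin n₁ ⊕ Fin n₁ ≃ Fin (2 * n₁),
      W ≤ (Matrix.of fun r c : Fin n₁ → Bool =>
        (((ArithmeticFunction.liouville
          (Nat.ofBits (fun j : Fin (2 * n₁) => Sum.elim r c (π₁.symm j)) + 1) : ℤ) : ℂ))).rank := by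
  constructor
  · intro h W m
    obtain ⟨n₀, hn₀⟩ := h W
    exact ⟨max n₀ m, le_max_right _ _, fun π₁ => hn₀ _ (le_max_left _ _) π₁⟩
  · intro h
    refine liouvilleCutRank_of_rankAtOneScale fun W => ?_
    obtain ⟨n₁, -, hn₁⟩ := h W 0
    exact ⟨n₁, hn₁⟩

/-! ### §3 The stub for `W ≤ 8` -/

/-- **`stub_rankAtOneScale` for every `W ≤ 8`** (from the tree's rung `W = 8` of the crux,
`LiouvilleSarnakCutRankEight.liouvilleCutRank_of_le_eight`, at its threshold level). [folklore] -/
theorem rankAtOneScale_of_le_eight : ∀ W ≤ 8, ∃ n₁ : ℕ, ∀ π₁ : Fin n₁ ⊕ Fin n₁ ≃ Fin (2 * n₁),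
    W ≤ (Matrix.of fun r c : Fin n₁ → Bool =>
      (((ArithmeticFunction.liouville
        (Nat.ofBits (fun j : Fin (2 * n₁) => Sum.elim r c (π₁.symm j)) + 1) : ℤ) : ℂ))).rank := by
  intro W hW
  obtain ⟨n₀, hn₀⟩ := liouvilleCutRank_of_le_eight W hW
  exact ⟨n₀, fun π₁ => hn₀ n₀ le_rfl π₁⟩

end Summit.ValiantsHypothesis.ValiantsHypothesis.Theorems.LiouvilleSarnakLiouvilleCutRank.OneScale
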